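import Summits.Ventures.PercRepro.Night2ThreeTwoMissedCap
import Summits.Ventures.PercRepro.Night2LocalRuleMissed

/-!
# PercRepro — the cell `(3, 2)`: the missed-point sources of a target (night-2, gen 25)

The big pairs of the cell `(3, 2)` (`|B ∖ K| ≥ 4`) route their losses by `dshMissed` (`Night2LocalRuleMissed`): the
loss of `(B, z)` is split over the targets `B ∪ {z, x}`, `x` another point missed by `B`.  A target `S` therefore
receives from its **missed-point sources** — the big thin members `B ⊆ S` with `S ∖ B` a pair of points missed by `B`
(`missedSources`) — at most `1/20` each (`loss_le_of_big_three_two`), and keeps `cap2 ≥ 11/60` as soon as it has one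
(`cap2_ge_of_missed_three_two`).  So the column bound `dload S ≤ cap2 S` holds wherever `S` has at most three sources.
This module sets up the sources and the two facts the common-line argument of `Night2ThreeTwoMissedCol` rests on:

* `missedSources M q G P S`, `source_of_mem_missedTargets`, **`dload_missed_le_sum_sources`** (the load of `S` is
  carried by its sources), `source_sum_le_of_three_two`, **`dload_missed_le_card_sources_three_two`** (cell `(3, 2)`:
  `dload S ≤ #sources(S)/20`);
* `source_eq_inter_clF` (a source is the trace of its hyperplane on `S`), `clF_mem_flatsQ_five_of_mem_Uq`,
  `rkN_clF_eq_five_of_mem_Uq`;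
* **`rkN_inter_sdiff_coloops_le_two_of_sources`**: two distinct sources `B, B'` of `S` span distinct hyperplanes of
  `G`, whose intersection has rank `≤ 4` (submodularity) and contains `K`; so `(B ∩ B') ∖ K` has rank `≤ 2`;
* **`subset_clF_inter_of_rkN_le_two`**: two sets of rank `≤ 2` sharing two points lie in one line.
-/

namespace PercRepro.Shadow

open Finset PerFlat ThmH

variable {α : Type*} [DecidableEq α] {M : Matroid α} [M.Finite]

section Sources

variable (M) (q : ℕ) (G : Finset α) (P : Finset α → Prop) [DecidablePred P]

open scoped Classical in
/-- The missed-point sources of a target `S`: the `P`-thin members `B ⊆ S` with `S ∖ B` a pair of points missed by `B`. -/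
noncomputable def missedSources (S : Finset α) : Finset (Finset α) :=
  ((thinMembers M q G).filter P).filter (fun B => B ⊆ S ∧ (S \ B).card = 2 ∧ S \ B ⊆ G \ clF M B)

end Sources

section SourceLemmas

variable {q : ℕ} {G : Finset α} {P : Finset α → Prop} [DecidablePred P]

open scoped Classical in
/-- Membership in `missedSources`. -/
theorem mem_missedSources {S B : Finset α} :
    B ∈ missedSources M q G P S ↔
      (B ∈ thinMembers M q G ∧ P B) ∧ B ⊆ S ∧ (S \ B).card = 2 ∧ S \ B ⊆ G \ clF M B := by
  unfold missedSources
  rw [Finset.mem_filter, Finset.mem_filter]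

/-- A missed-point target of `(B, z)` has `B` as a source and `z ∈ S ∖ B`. -/
theorem source_of_mem_missedTargets {S B : Finset α} (hB : B ∈ thinMembers M q G) (hP : P B) {z : α}
    (hz : z ∈ G \ clF M B) (hS : S ∈ missedTargets M G B z) :
    B ∈ missedSources M q G P S ∧ z ∈ S \ B := by
  obtain ⟨x, hx, hxz, rfl⟩ := mem_missedTargets.1 hS
  have hBU : B ∈ Uq M (q + 2) q := (mem_membersIn.1 (mem_thinMembers.1 hB).1).1
  have hzB : z ∉ B := notMem_of_notMem_clF hBU (Finset.mem_sdiff.1 hz).2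
  have hxB : x ∉ B := notMem_of_notMem_clF hBU (Finset.mem_sdiff.1 hx).2
  have hsd : insert x (insert z B) \ B = {x, z} := by
    ext a
    simp only [Finset.mem_sdiff, Finset.mem_insert, Finset.mem_singleton]
    constructor
    · rintro ⟨h | h | h, haB⟩
      · exact Or.inl h
      · exact Or.inr h
      · exact absurd h haB
    · rintro (rfl | rfl)
      · exact ⟨Or.inl rfl, hxB⟩
      · exact ⟨Or.inr (Or.inl rfl), hzB⟩
  refine ⟨mem_missedSources.2 ⟨⟨hB, hP⟩, ?_, ?_, ?_⟩, ?_⟩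
  · exact (Finset.subset_insert z B).trans (Finset.subset_insert x _)
  · rw [hsd]; exact Finset.card_pair hxz
  · rw [hsd]
    intro a ha
    rw [Finset.mem_insert, Finset.mem_singleton] at ha
    rcases ha with rfl | rfl
    · exact hx
    · exact hz
  · rw [hsd, Finset.mem_insert, Finset.mem_singleton]; exact Or.inr rfl

open scoped Classical in
/-- The distance-one load of `S` through `dshMissed` is carried by its sources: at most
`Σ_{z ∈ S ∖ B} loss B z / (|G ∖ cl B| − 1)` per source `B`. -/
theorem dload_missed_le_sum_sources (hG : G ∈ flatsQ M (q + 1)) (hd : (gr M \ G).card ≤ q) (S : Finset α) :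
    dload M q G P (dshMissed M q G) S ≤
      ∑ B ∈ missedSources M q G P S, ∑ z ∈ S \ B, loss M q G B z / (((G \ clF M B).card : ℚ) - 1) := by
  unfold dload
  have hsub : missedSources M q G P S ⊆ (thinMembers M q G).filter P := fun B hB =>
    Finset.mem_filter.2 (mem_missedSources.1 hB).1
  rw [← Finset.sum_subset hsub]
  · apply Finset.sum_le_sum
    intro B hB
    have hB' := mem_missedSources.1 hB
    have hBg : B ⊆ gr M := (mem_Uq.1 (mem_membersIn.1 (mem_thinMembers.1 hB'.1.1).1).1).1
    -- the inner sum over `z ∈ G ∖ cl B` is the sum over the `z` with `S ∈ missedTargets B z`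
    rw [← Finset.sum_filter_add_sum_filter_not (G \ clF M B) (fun z => S ∈ missedTargets M G B z)]
    have h0 : ∑ z ∈ (G \ clF M B).filter (fun z => ¬ S ∈ missedTargets M G B z), dshMissed M q G B z S = 0 := by
      apply Finset.sum_eq_zero
      intro z hz
      rw [Finset.mem_filter] at hz
      unfold dshMissed
      rw [if_neg hz.2]
    rw [h0, add_zero]
    have hle : (G \ clF M B).filter (fun z => S ∈ missedTargets M G B z) ⊆ S \ B := by
      intro z hz
      rw [Finset.mem_filter] at hz
      exact (source_of_mem_missedTargets hB'.1.1 hB'.1.2 hz.1 hz.2).2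
    calc ∑ z ∈ (G \ clF M B).filter (fun z => S ∈ missedTargets M G B z), dshMissed M q G B z S
        = ∑ z ∈ (G \ clF M B).filter (fun z => S ∈ missedTargets M G B z),
            loss M q G B z / (((G \ clF M B).card : ℚ) - 1) := by
          apply Finset.sum_congr rfl
          intro z hz
          rw [Finset.mem_filter] at hz
          exact dshMissed_of_mem hBg hz.1 hz.2
      _ ≤ ∑ z ∈ S \ B, loss M q G B z / (((G \ clF M B).card : ℚ) - 1) := by
          apply Finset.sum_le_sum_of_subset_of_nonneg hle
          intro z hz _
          have h2 : 2 ≤ (G \ clF M B).card :=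
            two_le_card_sdiff_of_not_lay0 hG hd (mem_thinMembers.1 hB'.1.1).1 (mem_thinMembers.1 hB'.1.1).2
          have h2' : (2 : ℚ) ≤ ((G \ clF M B).card : ℚ) := by exact_mod_cast h2
          exact div_nonneg (loss_nonneg' hG hd B z) (by linarith)
  · intro B hB hBn
    apply Finset.sum_eq_zero
    intro z hz
    unfold dshMissed
    split_ifs with hS
    · exfalso
      rw [Finset.mem_filter] at hB
      exact hBn (source_of_mem_missedTargets hB.1 hB.2 hz hS).1
    · rfl

end SourceLemmas

section ThreeTwoCol

variable {G : Finset α}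

/-- In the cell `(3, 2)` a big source contributes at most `1/20` to the load of its target. -/
theorem source_sum_le_of_three_two (hG : G ∈ flatsQ M (5 + 1)) (hd : (gr M \ G).card = 3) (hk : kColoops M G = 2)
    (hs : ∀ e ∈ gr M, ∀ f ∈ gr M, e ≠ f → rkN M {e, f} = 2) (hl : ∀ e ∈ gr M, M.Indep {e})
    {P : Finset α → Prop} [DecidablePred P] (hP : ∀ B, P B → 4 ≤ (B \ coloops M G).card) {S B : Finset α}
    (hB : B ∈ missedSources M 5 G P S) :
    ∑ z ∈ S \ B, loss M 5 G B z / (((G \ clF M B).card : ℚ) - 1) ≤ 1 / 20 := by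
  have hd' : (gr M \ G).card ≤ 5 := by omega
  obtain ⟨⟨hthin, hPB⟩, -, hc2, hsub⟩ := mem_missedSources.1 hB
  have hm2 : 2 ≤ (G \ clF M B).card :=
    two_le_card_sdiff_of_not_lay0 hG hd' (mem_thinMembers.1 hthin).1 (mem_thinMembers.1 hthin).2
  have hm2' : (2 : ℚ) ≤ ((G \ clF M B).card : ℚ) := by exact_mod_cast hm2
  have hbig := hP B hPB
  calc ∑ z ∈ S \ B, loss M 5 G B z / (((G \ clF M B).card : ℚ) - 1)
      ≤ ∑ _z ∈ S \ B, (1 / 40 : ℚ) / (((G \ clF M B).card : ℚ) - 1) := by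
        apply Finset.sum_le_sum
        intro z hz
        exact div_le_div_of_nonneg_right (loss_le_of_big_three_two hG hd hk hs hl hthin hbig (hsub hz))
          (by linarith)
    _ = 2 * ((1 / 40 : ℚ) / (((G \ clF M B).card : ℚ) - 1)) := by
        rw [Finset.sum_const, nsmul_eq_mul, hc2]; push_cast; ring
    _ ≤ 2 * ((1 / 40 : ℚ) / 1) := by
        gcongr
        linarith
    _ = 1 / 20 := by norm_num

/-- In the cell `(3, 2)`: `dload S ≤ #sources(S) / 20`. -/
theorem dload_missed_le_card_sources_three_two (hG : G ∈ flatsQ M (5 + 1)) (hd : (gr M \ G).card = 3)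
    (hk : kColoops M G = 2) (hs : ∀ e ∈ gr M, ∀ f ∈ gr M, e ≠ f → rkN M {e, f} = 2)
    (hl : ∀ e ∈ gr M, M.Indep {e}) {P : Finset α → Prop} [DecidablePred P]
    (hP : ∀ B, P B → 4 ≤ (B \ coloops M G).card) (S : Finset α) :
    dload M 5 G P (dshMissed M 5 G) S ≤ ((missedSources M 5 G P S).card : ℚ) * (1 / 20) := by
  have hd' : (gr M \ G).card ≤ 5 := by omega
  calc dload M 5 G P (dshMissed M 5 G) S
      ≤ ∑ B ∈ missedSources M 5 G P S, ∑ z ∈ S \ B, loss M 5 G B z / (((G \ clF M B).card : ℚ) - 1) :=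
        dload_missed_le_sum_sources hG hd' S
    _ ≤ ∑ _B ∈ missedSources M 5 G P S, (1 / 20 : ℚ) :=
        Finset.sum_le_sum (fun B hB => source_sum_le_of_three_two hG hd hk hs hl hP hB)
    _ = ((missedSources M 5 G P S).card : ℚ) * (1 / 20) := by rw [Finset.sum_const, nsmul_eq_mul]

end ThreeTwoCol

section CommonLine

variable {G : Finset α}

/-- A source `B` of `S` is the trace of its hyperplane on `S`: `B = S ∩ cl B`. -/
theorem source_eq_inter_clF {q : ℕ} {P : Finset α → Prop} [DecidablePred P] {S B : Finset α}
    (hB : B ∈ missedSources M q G P S) : B = S ∩ clF M B := by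
  obtain ⟨⟨hthin, -⟩, hBS, -, hsub⟩ := mem_missedSources.1 hB
  have hBU : B ∈ Uq M (q + 2) q := (mem_membersIn.1 (mem_thinMembers.1 hthin).1).1
  ext a
  constructor
  · intro ha; exact Finset.mem_inter.2 ⟨hBS ha, subset_clF hBU ha⟩
  · intro ha
    rw [Finset.mem_inter] at ha
    by_contra haB
    have : a ∈ S \ B := Finset.mem_sdiff.2 ⟨ha.1, haB⟩
    exact (Finset.mem_sdiff.1 (hsub this)).2 ha.2

/-- The closure of a member of `Uq M 7 5` is a rank-`5` flat. -/
theorem clF_mem_flatsQ_five_of_mem_Uq {B : Finset α} (hB : B ∈ Uq M (5 + 2) 5) : clF M B ∈ flatsQ M (4 + 1) := by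
  have hBr : M.eRk (B : Set α) = ((5 : ℕ) : ℕ∞) := (mem_Uq.1 hB).2.1
  rw [mem_flatsQ]
  refine ⟨?_, ?_, ?_⟩
  · rw [← Finset.coe_subset, coe_clF, coe_gr]; exact M.closure_subset_ground _
  · rw [coe_clF]; exact M.isFlat_closure _
  · rw [coe_clF, M.eRk_closure_eq, hBr]

/-- The rank (as `rkN`) of the closure of a member of `Uq M 7 5` is `5`. -/
theorem rkN_clF_eq_five_of_mem_Uq {B : Finset α} (hB : B ∈ Uq M (5 + 2) 5) : rkN M (clF M B) = 5 := by
  have h := (mem_flatsQ.1 (clF_mem_flatsQ_five_of_mem_Uq hB)).2.2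
  rw [eRk_eq_rkN] at h
  exact_mod_cast h

open scoped Classical in
/-- **Two distinct sources of a target have `(B ∩ B') ∖ K` of rank `≤ 2`** (cell `(3, 2)`): their hyperplanes are
distinct, so their intersection has rank `≤ 4`, and the two coloops account for two of them. -/
theorem rkN_inter_sdiff_coloops_le_two_of_sources (hG : G ∈ flatsQ M (5 + 1)) (hd : (gr M \ G).card ≤ 5)
    (hk : kColoops M G = 2) {P : Finset α → Prop} [DecidablePred P] {S B B' : Finset α}
    (hB : B ∈ missedSources M 5 G P S) (hB' : B' ∈ missedSources M 5 G P S) (hne : B ≠ B') :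
    rkN M ((B ∩ B') \ coloops M G) ≤ 2 := by
  have hGg : G ⊆ gr M := (mem_flatsQ.1 hG).1
  have hthin : B ∈ thinMembers M 5 G := (mem_missedSources.1 hB).1.1
  have hthin' : B' ∈ thinMembers M 5 G := (mem_missedSources.1 hB').1.1
  have hBU : B ∈ Uq M (5 + 2) 5 := (mem_membersIn.1 (mem_thinMembers.1 hthin).1).1
  have hB'U : B' ∈ Uq M (5 + 2) 5 := (mem_membersIn.1 (mem_thinMembers.1 hthin').1).1
  have hHG : clF M B ⊆ G := (mem_membersIn.1 (mem_thinMembers.1 hthin).1).2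
  have hH'G : clF M B' ⊆ G := (mem_membersIn.1 (mem_thinMembers.1 hthin').1).2
  have hK : coloops M G ⊆ B := coloops_subset_of_mem_thinMembers hG hd hthin
  have hK' : coloops M G ⊆ B' := coloops_subset_of_mem_thinMembers hG hd hthin'
  set H := clF M B with hH
  set H' := clF M B' with hH'
  have hHr : rkN M H = 5 := rkN_clF_eq_five_of_mem_Uq hBU
  have hH'r : rkN M H' = 5 := rkN_clF_eq_five_of_mem_Uq hB'U
  -- the hyperplanes are distinct
  have hHne : H ≠ H' := by
    intro h
    apply hne
    rw [source_eq_inter_clF hB, source_eq_inter_clF hB', ← hH, ← hH', h]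
  -- `H' ⊄ H`: else they coincide (same rank)
  have hnsub : ¬ H' ⊆ H := by
    intro hsub
    apply hHne
    symm
    exact flat_eq_of_subset_of_eRk_eq (clF_mem_flatsQ_five_of_mem_Uq hBU)
      (by rw [hH', coe_clF]; exact M.isFlat_closure _) hsub
      (by rw [hH', coe_clF, M.eRk_closure_eq]; exact (mem_Uq.1 hB'U).2.1)
  obtain ⟨e, heH', heH⟩ := Finset.not_subset.1 hnsub
  -- `rkN (H ∪ H') = 6`
  have hHclosed : clF M H = H := by
    rw [hH, ← Finset.coe_inj, coe_clF, coe_clF, M.closure_closure]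
  have hU6 : 6 ≤ rkN M (H ∪ H') := by
    have h1 : rkN M (insert e H) = rkN M H + 1 :=
      rkN_insert_of_notMem_clF (hGg (hH'G heH')) (by rw [hHclosed]; exact heH)
    have h2 : insert e H ⊆ H ∪ H' := Finset.insert_subset (Finset.mem_union_right _ heH')
      Finset.subset_union_left
    have := rkN_mono (M := M) h2
    omega
  have hsub := rkN_submod (M := M) H H'
  have hI4 : rkN M (H ∩ H') ≤ 4 := by omega
  -- the coloops account for two of the ranks
  have hKI : coloops M G ⊆ H ∩ H' := Finset.subset_inter (hK.trans (subset_clF hBU)) (hK'.trans (subset_clF hB'U))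
  have hcol : ∀ y ∈ coloops M G, y ∈ G ∧ y ∉ clF M (G.erase y) := fun y hy => mem_coloops.1 hy
  have hXG : (H ∩ H') \ coloops M G ⊆ G := fun a ha => hHG (Finset.mem_inter.1 (Finset.mem_sdiff.1 ha).1).1
  have hdisj : Disjoint (coloops M G) ((H ∩ H') \ coloops M G) := Finset.disjoint_sdiff
  have hunion : coloops M G ∪ ((H ∩ H') \ coloops M G) = H ∩ H' := Finset.union_sdiff_of_subset hKI
  have hI : rkN M (H ∩ H') = 2 + rkN M ((H ∩ H') \ coloops M G) := by
    have h := eRk_union_coloops hGg (coloops M G) hcol hXG hdisj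
    rw [hunion, eRk_eq_rkN, eRk_eq_rkN, ← kColoops_eq_card_coloops, hk] at h
    exact_mod_cast h
  have hmono : rkN M ((B ∩ B') \ coloops M G) ≤ rkN M ((H ∩ H') \ coloops M G) :=
    rkN_mono (Finset.sdiff_subset_sdiff (Finset.inter_subset_inter (subset_clF hBU) (subset_clF hB'U))
      (Finset.Subset.refl _))
  omega

/-- **Two sets of rank `≤ 2` sharing two points lie in one line**: `X ⊆ cl (X ∩ X')`. -/
theorem subset_clF_inter_of_rkN_le_two (hs : ∀ e ∈ gr M, ∀ f ∈ gr M, e ≠ f → rkN M {e, f} = 2)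
    {X X' : Finset α} (hX : X ⊆ gr M) (hrX : rkN M X ≤ 2) (h2 : 2 ≤ (X ∩ X').card) :
    X ⊆ clF M (X ∩ X') := by
  have hI : 2 ≤ rkN M (X ∩ X') :=
    two_le_rkN_of_two_le_card hs (Finset.inter_subset_left.trans hX) h2
  have hmono : rkN M (X ∩ X') ≤ rkN M X := rkN_mono Finset.inter_subset_left
  have heq : rkN M (X ∩ X') = rkN M X := by omega
  have h := subset_closure_of_rkN_eq hX Finset.inter_subset_left heq
  rw [← coe_clF, Finset.coe_subset] at h
  exact h

end CommonLine

end PercRepro.Shadow
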